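import Mathlib
import Summits.NavierStokesRegularity.NavierStokesRegularity.Theorems.LerayQuarterDissipationFiniteDissipationLiouvilleCriticalProductionCredit
import Summits.NavierStokesRegularity.NavierStokesRegularity.Theorems.LerayQuarterDissipationFiniteDissipationLiouvilleEndpointSchemeApex
import HarnessLib

/-!
# Route `LerayQuarterDissipation`, crux `FiniteDissipationLiouville` (stmt-NavierStokesRegularity-22144), line `birth` —
# CRITICAL PRODUCTION WITH PALINSTROPHY CREDIT NEAR THE APEX IS A REGULARITY CRITERION

Seat ns-lqd-lead g18 (LEAD of 22144, cell ns-idea-3; helper `--supports` 22144).  The all-time row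
`…CriticalProductionCredit.eq_zero_of_critical_production_credit` (`a < 1`:
`(−t)(⟪ω, DV ω⟫ − a|∇ω|²_F) ≤ |ω|²` everywhere ⇒ `V ≡ 0`, envelope-free) is made EVENTUAL towards the apex, in the
crux's own vocabulary (KNSS-gauge Type-I field + the route's dissipation law `∫|∇V(s)|² ≤ K/√(−s)`, no envelope):

* `critProdCredit_nsRescale_from` — the windowed hypothesis on `[τ, 0) × ℝ³` rescales to `[τ/c², 0) × ℝ³`;
* `critProdCredit_of_limit_eventually` — if the members of a KNSS-convergent sequence (`…Compactness.seqLimit`: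
  uniform convergence on slab pieces, pointwise gradients) satisfy the hypothesis on windows `[τ_j, 0)` with
  `τ_j → −∞`, the limit satisfies it everywhere (second derivatives converge by `…EndpointScheme.tendsto_fderiv_curl_of_unif`);
* **`not_singular_of_critProdCredit_near_apex`** — `IsTypeIAncientMild C V`, the law, `a < 1` and the hypothesis on
  `[τ, 0) × ℝ³` for some `τ < 0` ⇒ `V` is NOT singular at the space-time origin: the zoom-in sequence
  `V_j = nsRescale e^{−j} V` keeps class, law and singularity and satisfies the hypothesis on `[τe^{2j}, 0)`; its KNSS
  limit is singular (`…Compactness.persistent_singularity_seq`, ε-regularity) yet satisfies the hypothesis everywhere,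
  so it vanishes — absurd;
* `not_singular_of_critProdCredit_near_apex_of_envelope` — the same for the enveloped class (`HasTypeIDecay A V`,
  `C ≤ A`; the envelope implies the law, `…LambProductCollar.exists_uniform_law_of_envelope`);
* PORTRAIT `production_excess_accumulates_of_singular` — a singular finite-dissipation KNSS Type-I field has, for
  every `a < 1` and every `τ < 0`, a point `(s, y)` with `τ ≤ s < 0` and `|ω|² < (−s)(⟪ω, DV ω⟫ − a|∇ω|²_F)`: the
  super-critical production ACCUMULATES AT THE APEX.

WHAT THIS IS NOT: not a claim about Navier–Stokes regularity and not the crux — a regularity criterion / portrait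
clause for the hypothetical singular element (bears_on LADDER-NS N0).
-/

noncomputable section

-- the summit and its single sub-problem share the name (CONVENTIONS §1), as in every Theorems file
set_option linter.dupNamespace false

namespace Summit.NavierStokesRegularity.NavierStokesRegularity.Theorems.FiniteDissipationLiouville.CriticalProduction

open MeasureTheory Set Function Filter Topology TopologicalSpace Metric InnerProductSpace
open scoped RealInnerProductSpace InnerProductSpace ContDiff ENNReal
open Literature.Analysis Literature.Analysis.FluidPDE
open Summit.NavierStokesRegularity.NavierStokesRegularity.Theorems
open Summit.NavierStokesRegularity.NavierStokesRegularity.Theorems.RecurrentReductionD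
open Summit.NavierStokesRegularity.NavierStokesRegularity.Theorems.PoloidalWindowDoorPoloidalWindowRigidityPoloidalExtremal
open Summit.NavierStokesRegularity.NavierStokesRegularity.Theorems.FiniteDissipationLiouville.EndpointScheme
open Summit.NavierStokesRegularity.NavierStokesRegularity.Theorems.FiniteDissipationLiouville.LambProduct
open Summit.NavierStokesRegularity.NavierStokesRegularity.Theorems.FiniteDissipationLiouville.CrossFlow

variable {C : ℝ} {V : ℝ → EuclideanSpace ℝ (Fin 3) → EuclideanSpace ℝ (Fin 3)}

/-! ### Windows rescale; eventual closedness -/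

/-- The windowed hypothesis rescales: if `(−s)(⟪ω, Du ω⟫ − a|∇ω|²_F) ≤ |ω|²` on `[τ, 0) × ℝ³` then the same holds
for `nsRescale c u` on `[τ/c², 0) × ℝ³` (`c > 0`). [folklore] -/
theorem critProdCredit_nsRescale_from {a τ : ℝ} {u : ℝ → EuclideanSpace ℝ (Fin 3) → EuclideanSpace ℝ (Fin 3)}
    {c : ℝ} (hc : 0 < c)
    (h : ∀ s : ℝ, τ ≤ s → s < 0 → ∀ y, (-s) * (⟪curl (u s) y, fderiv ℝ (u s) y (curl (u s) y)⟫_ℝ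
        - a * frobeniusNormSq (fderiv ℝ (curl (u s)) y)) ≤ ⟪curl (u s) y, curl (u s) y⟫_ℝ) :
    ∀ s : ℝ, τ / c ^ 2 ≤ s → s < 0 → ∀ y, (-s) * (⟪curl (nsRescale c u s) y,
        fderiv ℝ (nsRescale c u s) y (curl (nsRescale c u s) y)⟫_ℝ
        - a * frobeniusNormSq (fderiv ℝ (curl (nsRescale c u s)) y)) ≤
      ⟪curl (nsRescale c u s) y, curl (nsRescale c u s) y⟫_ℝ := by
  intro s hτs hs y
  have hc2 : 0 < c ^ 2 := pow_pos hc 2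
  have hτ' : τ ≤ c ^ 2 * s := by
    rw [div_le_iff₀ hc2] at hτs
    linarith [hτs]
  -- the all-time lemma applied to the field restricted in time is not available; redo the algebra
  have key := h (c ^ 2 * s) hτ' (mul_neg_of_pos_of_neg hc2 hs) (c • y)
  rw [curl_nsRescale_slice, fderiv_nsRescale_slice, fderiv_curl_nsRescale, frobeniusNormSq_smul_eq]
  simp only [smul_apply, map_smul, real_inner_smul_left, real_inner_smul_right]
  have hc4 : 0 ≤ c ^ 2 * c ^ 2 := by positivity
  have e6 : (c * c * c) ^ 2 = c ^ 2 * (c ^ 2 * c ^ 2) := by ring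
  rw [e6]
  have h2 := mul_le_mul_of_nonneg_left key hc4
  have e7 : -s * (c ^ 2 * (c ^ 2 * (c ^ 2 * ⟪curl (u (c ^ 2 * s)) (c • y),
        (fderiv ℝ (u (c ^ 2 * s)) (c • y)) (curl (u (c ^ 2 * s)) (c • y))⟫_ℝ)) -
        a * (c ^ 2 * (c ^ 2 * c ^ 2) * frobeniusNormSq (fderiv ℝ (curl (u (c ^ 2 * s))) (c • y)))) =
      c ^ 2 * c ^ 2 * (-(c ^ 2 * s) * (⟪curl (u (c ^ 2 * s)) (c • y),
        (fderiv ℝ (u (c ^ 2 * s)) (c • y)) (curl (u (c ^ 2 * s)) (c • y))⟫_ℝ -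
        a * frobeniusNormSq (fderiv ℝ (curl (u (c ^ 2 * s))) (c • y)))) := by ring
  have e8 : c ^ 2 * (c ^ 2 * ⟪curl (u (c ^ 2 * s)) (c • y), curl (u (c ^ 2 * s)) (c • y)⟫_ℝ) =
      c ^ 2 * c ^ 2 * ⟪curl (u (c ^ 2 * s)) (c • y), curl (u (c ^ 2 * s)) (c • y)⟫_ℝ := by ring
  rw [e7, e8]
  exact h2

/-- **Eventual closedness.**  Along a KNSS-convergent sequence of the class (uniform convergence on the slab
pieces, pointwise convergence of gradients) whose members satisfy the hypothesis on windows `[τ_j, 0) × ℝ³` with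
`τ_j → −∞`, the limit satisfies it on all of `t < 0`. [cite: KochNadirashviliSereginSverak2009, Prop. 4.1 (arXiv:0709.3599)] -/
theorem critProdCredit_of_limit_eventually {a : ℝ} {w : ℕ → ℝ → EuclideanSpace ℝ (Fin 3) → EuclideanSpace ℝ (Fin 3)}
    {W : ℝ → EuclideanSpace ℝ (Fin 3) → EuclideanSpace ℝ (Fin 3)} {τs : ℕ → ℝ}
    (hw : ∀ k, IsTypeIAncientMild C (w k)) (hW : IsTypeIAncientMild C W)
    (hunif : ∀ n : ℕ, TendstoUniformlyOn (fun j z => w j z.1 z.2) (fun z => W z.1 z.2) atTop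
      (Icc (-((n : ℝ) + 2)) (-(1 / ((n : ℝ) + 2))) ×ˢ
        closedBall (0 : EuclideanSpace ℝ (Fin 3)) ((n : ℝ) + 2)))
    (hgr : ∀ t < 0, ∀ x, Tendsto (fun j => fderiv ℝ (w j t) x) atTop (𝓝 (fderiv ℝ (W t) x)))
    (hτs : Tendsto τs atTop atBot)
    (h : ∀ k, ∀ s : ℝ, τs k ≤ s → s < 0 → ∀ y, (-s) * (⟪curl (w k s) y, fderiv ℝ (w k s) y (curl (w k s) y)⟫_ℝ
        - a * frobeniusNormSq (fderiv ℝ (curl (w k s)) y)) ≤ ⟪curl (w k s) y, curl (w k s) y⟫_ℝ) :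
    ∀ s < 0, ∀ y, (-s) * (⟪curl (W s) y, fderiv ℝ (W s) y (curl (W s) y)⟫_ℝ
        - a * frobeniusNormSq (fderiv ℝ (curl (W s)) y)) ≤ ⟪curl (W s) y, curl (W s) y⟫_ℝ := by
  intro s hs y
  have hD : Tendsto (fun j => fderiv ℝ (w j s) y) atTop (𝓝 (fderiv ℝ (W s) y)) := hgr s hs y
  have hc : Tendsto (fun j => curl (w j s) y) atTop (𝓝 (curl (W s) y)) := tendsto_curl_of_fderiv hD
  have hG : Tendsto (fun j => fderiv ℝ (curl (w j s)) y) atTop (𝓝 (fderiv ℝ (curl (W s)) y)) :=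
    tendsto_fderiv_curl_of_unif hw hW hunif hs y
  have happ : Tendsto (fun j => fderiv ℝ (w j s) y (curl (w j s) y)) atTop
      (𝓝 (fderiv ℝ (W s) y (curl (W s) y))) :=
    ((isBoundedBilinearMap_apply (𝕜 := ℝ) (E := EuclideanSpace ℝ (Fin 3))
      (F := EuclideanSpace ℝ (Fin 3))).continuous.tendsto (fderiv ℝ (W s) y, curl (W s) y)).comp (hD.prodMk_nhds hc)
  have hF : Tendsto (fun j => frobeniusNormSq (fderiv ℝ (curl (w j s)) y)) atTop
      (𝓝 (frobeniusNormSq (fderiv ℝ (curl (W s)) y))) := (continuous_frobeniusNormSq'.tendsto _).comp hG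
  have h1 : Tendsto (fun j => (-s) * (⟪curl (w j s) y, fderiv ℝ (w j s) y (curl (w j s) y)⟫_ℝ
      - a * frobeniusNormSq (fderiv ℝ (curl (w j s)) y))) atTop
      (𝓝 ((-s) * (⟪curl (W s) y, fderiv ℝ (W s) y (curl (W s) y)⟫_ℝ
        - a * frobeniusNormSq (fderiv ℝ (curl (W s)) y)))) :=
    ((hc.inner happ).sub (hF.const_mul a)).const_mul (-s)
  have h2 : Tendsto (fun j => ⟪curl (w j s) y, curl (w j s) y⟫_ℝ) atTop (𝓝 ⟪curl (W s) y, curl (W s) y⟫_ℝ) :=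
    hc.inner hc
  have hev : ∀ᶠ j in atTop, (-s) * (⟪curl (w j s) y, fderiv ℝ (w j s) y (curl (w j s) y)⟫_ℝ
      - a * frobeniusNormSq (fderiv ℝ (curl (w j s)) y)) ≤ ⟪curl (w j s) y, curl (w j s) y⟫_ℝ := by
    filter_upwards [hτs.eventually (eventually_le_atBot s)] with j hj
    exact h j s hj hs y
  exact le_of_tendsto_of_tendsto h1 h2 hev

/-! ### Near the apex: a regularity criterion -/

/-- **CRITICAL PRODUCTION WITH PALINSTROPHY CREDIT NEAR THE APEX FORBIDS THE SINGULARITY.**  Let `V` be a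
KNSS-gauge Type-I field with the dissipation law `∫|∇V(s)|² ≤ K/√(−s)`, `a < 1`, and suppose
`(−s)(⟪ω, DV ω⟫ − a|∇ω|²_F)(s, y) ≤ |ω(s, y)|²` for all `τ ≤ s < 0` and all `y` (some `τ < 0`).  Then `V` is not
singular at the space-time origin. [cite: KochNadirashviliSereginSverak2009, Prop. 4.1 (arXiv:0709.3599)] -/
theorem not_singular_of_critProdCredit_near_apex {a K : ℝ} (ha : a < 1) (hV : IsTypeIAncientMild C V)
    (hlaw : ∀ s : ℝ, s < 0 → ∫⁻ x, ‖fderiv ℝ (V s) x‖ₑ ^ 2 ≤ ENNReal.ofReal (K / Real.sqrt (-s)))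
    {τ : ℝ} (hτ : τ < 0)
    (hP : ∀ s : ℝ, τ ≤ s → s < 0 → ∀ y, (-s) * (⟪curl (V s) y, fderiv ℝ (V s) y (curl (V s) y)⟫_ℝ
        - a * frobeniusNormSq (fderiv ℝ (curl (V s)) y)) ≤ ⟪curl (V s) y, curl (V s) y⟫_ℝ) :
    ¬ (∀ r > 0, ∀ M : ℝ, ∃ t ∈ Ioo (-(r ^ 2)) (0 : ℝ),
      ∃ x ∈ ball (0 : EuclideanSpace ℝ (Fin 3)) r, M < ‖V t x‖) := by
  intro hsing
  -- the zoom-IN sequence: class, law, singularity, windows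
  obtain ⟨u, hudef⟩ : ∃ u : ℕ → ℝ → EuclideanSpace ℝ (Fin 3) → EuclideanSpace ℝ (Fin 3),
      ∀ j, u j = nsRescale (Real.exp (-(j : ℝ))) V := ⟨_, fun j => rfl⟩
  have hu : ∀ j, IsTypeIAncientMild C (u j) := fun j => by
    rw [hudef]; exact hV.nsRescale (Real.exp_pos _)
  have hlawu : ∀ j, ∀ s : ℝ, s < 0 →
      ∫⁻ x, ‖fderiv ℝ (u j s) x‖ₑ ^ 2 ≤ ENNReal.ofReal (K / Real.sqrt (-s)) := fun j => by
    rw [hudef]; exact dissipationLaw_nsRescale hlaw (Real.exp_pos _)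
  have hsu : ∀ j, ∀ r > 0, ∀ M : ℝ, ∃ t ∈ Ioo (-(r ^ 2)) (0 : ℝ),
      ∃ x ∈ ball (0 : EuclideanSpace ℝ (Fin 3)) r, M < ‖u j t x‖ := fun j => by
    rw [hudef]; exact singularAtOrigin_nsRescale hsing (Real.exp_pos _)
  have hPu : ∀ j : ℕ, ∀ s : ℝ, τ / Real.exp (-(j : ℝ)) ^ 2 ≤ s → s < 0 → ∀ y,
      (-s) * (⟪curl (u j s) y, fderiv ℝ (u j s) y (curl (u j s) y)⟫_ℝ
        - a * frobeniusNormSq (fderiv ℝ (curl (u j s)) y)) ≤ ⟪curl (u j s) y, curl (u j s) y⟫_ℝ := fun j => by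
    rw [hudef]; exact critProdCredit_nsRescale_from (Real.exp_pos _) hP
  -- its KNSS limit: singular, yet with the all-time property
  obtain ⟨ψ, hψ, W, hW, hunif, hpt, hgr⟩ := Compactness.seqLimit hu
  have hψr : Tendsto (fun j => ((ψ j : ℕ) : ℝ)) atTop atTop :=
    tendsto_natCast_atTop_atTop.comp hψ.tendsto_atTop
  have hWsing := Compactness.persistent_singularity_seq (w := fun j => u (ψ j))
    (fun j => hu _) (fun j => hlawu _) (fun j => hsu _) hW hunif
  have hτj : Tendsto (fun j => τ / Real.exp (-((ψ j : ℕ) : ℝ)) ^ 2) atTop atBot := by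
    have e : ∀ j, τ / Real.exp (-((ψ j : ℕ) : ℝ)) ^ 2 = τ * Real.exp (2 * ((ψ j : ℕ) : ℝ)) := by
      intro j
      rw [div_eq_mul_inv, ← Real.exp_nat_mul, ← Real.exp_neg]
      congr 1; push_cast; ring_nf
    simp_rw [e]
    have h2 : Tendsto (fun j => Real.exp (2 * ((ψ j : ℕ) : ℝ))) atTop atTop :=
      Real.tendsto_exp_atTop.comp (hψr.const_mul_atTop (by norm_num))
    exact h2.const_mul_atTop_of_neg hτ
  have hPW := critProdCredit_of_limit_eventually (w := fun j => u (ψ j)) (fun j => hu _) hW hunif hgr hτj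
    (fun j => hPu (ψ j))
  have hW0 : ∀ t < 0, ∀ x, W t x = 0 := eq_zero_of_critical_production_credit ha hW hPW
  -- contradiction
  obtain ⟨t, ht, x, -, hM⟩ := hWsing 1 one_pos 0
  rw [hW0 t ht.2 x, norm_zero] at hM
  exact lt_irrefl _ hM

/-- The same on the ENVELOPED class: `IsTypeIAncientMild C V`, `C ≤ A`, `HasTypeIDecay A V` (the envelope implies
the dissipation law, `…LambProductCollar.exists_uniform_law_of_envelope`), `a < 1`, hypothesis on `[τ, 0) × ℝ³`
⇒ not singular. [cite: KochNadirashviliSereginSverak2009, Prop. 4.1 (arXiv:0709.3599)] -/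
theorem not_singular_of_critProdCredit_near_apex_of_envelope {a A : ℝ} (ha : a < 1) (hV : IsTypeIAncientMild C V)
    (hCA : C ≤ A) (hdec : HasTypeIDecay A V) {τ : ℝ} (hτ : τ < 0)
    (hP : ∀ s : ℝ, τ ≤ s → s < 0 → ∀ y, (-s) * (⟪curl (V s) y, fderiv ℝ (V s) y (curl (V s) y)⟫_ℝ
        - a * frobeniusNormSq (fderiv ℝ (curl (V s)) y)) ≤ ⟪curl (V s) y, curl (V s) y⟫_ℝ) :
    ¬ (∀ r > 0, ∀ M : ℝ, ∃ t ∈ Ioo (-(r ^ 2)) (0 : ℝ),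
      ∃ x ∈ ball (0 : EuclideanSpace ℝ (Fin 3)) r, M < ‖V t x‖) := by
  obtain ⟨K, hK⟩ := exists_uniform_law_of_envelope A
  exact not_singular_of_critProdCredit_near_apex ha (isTypeIAncientMild_of_le hV hCA)
    (hK (isTypeIAncientMild_of_le hV hCA) hdec) hτ hP

/-- **PORTRAIT: super-critical production accumulates at the apex.**  A KNSS-gauge Type-I field with the
dissipation law that IS singular at the origin has, for every `a < 1` and every `τ < 0`, a point `(s, y)` with
`τ ≤ s < 0` and `|ω(s,y)|² < (−s)(⟪ω, DV ω⟫ − a|∇ω|²_F)(s, y)`. [cite: KochNadirashviliSereginSverak2009, Prop. 4.1 (arXiv:0709.3599)] -/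
theorem production_excess_accumulates_of_singular {a K : ℝ} (ha : a < 1) (hV : IsTypeIAncientMild C V)
    (hlaw : ∀ s : ℝ, s < 0 → ∫⁻ x, ‖fderiv ℝ (V s) x‖ₑ ^ 2 ≤ ENNReal.ofReal (K / Real.sqrt (-s)))
    (hsing : ∀ r > 0, ∀ M : ℝ, ∃ t ∈ Ioo (-(r ^ 2)) (0 : ℝ),
        ∃ x ∈ ball (0 : EuclideanSpace ℝ (Fin 3)) r, M < ‖V t x‖)
    {τ : ℝ} (hτ : τ < 0) :
    ∃ s : ℝ, τ ≤ s ∧ s < 0 ∧ ∃ y : EuclideanSpace ℝ (Fin 3),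
      ⟪curl (V s) y, curl (V s) y⟫_ℝ < (-s) * (⟪curl (V s) y, fderiv ℝ (V s) y (curl (V s) y)⟫_ℝ
        - a * frobeniusNormSq (fderiv ℝ (curl (V s)) y)) := by
  by_contra h
  push Not at h
  exact not_singular_of_critProdCredit_near_apex ha hV hlaw hτ (fun s h1 h2 y => h s h1 h2 y) hsing

end Summit.NavierStokesRegularity.NavierStokesRegularity.Theorems.FiniteDissipationLiouville.CriticalProduction

end
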